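import Literature.AlgebraicGeometry.Resolution.RegularLocusPerfectField
import Summits.ResolutionOfSingularities.ResolutionOfSingularities.Theorems.WeightedInvariantClosedsGermEq
import Mathlib.RingTheory.Spectrum.Prime.Noetherian
import Mathlib.RingTheory.Localization.AtPrime.Basic
import Mathlib.RingTheory.Localization.LocalizationLocalization
import Mathlib.RingTheory.RegularLocalRing.Defs
import HarnessLib

/-!
# (open″)↾≤2 at monomial-type positions I: three shrinking lemmas on `Spec A` (rung P2, ORDER (o24-O))

Topic: `Summits/ResolutionOfSingularities/ResolutionOfSingularities/Theorems`. Helper (part 1 of 2) for the conjunct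
`JOpenPresentationForallSingLE2 p iotaOrd jContact` of the P2 rung statement `…HypersurfaceLocalGameEFT4SDimLETwo`
(res-type-073, p512950) of the door item `HypersurfaceCentreConstruction` (statement `stmt-ResolutionOfSingularities-19897`,
route `WeightedInvariant`), line `local-engine` of `res-L1-w43-plan-1`, ORDER (o24-O) (lead res-type-005; second hand
res-type-025 = the MONOMIAL-TYPE half, plan-1 08:16:45Z / 08:18:00Z).

[OURS · L1 W4.3] Replaces the role of NO printed item; NOT a statement of the manuscript
[claim: Hironaka2017, status: under-review]. AI work, weaker than expert review.

## Content (generic commutative algebra, no definitions)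

For a prime `𝔪` of a commutative ring `A`, three ways to shrink to a basic open `D(h) ∋ 𝔪`:
* `exists_not_mem_forall_isRegularLocalRing` — `A` of finite type over a PERFECT field and `A_𝔪` regular ⇒ some
  `D(h) ∋ 𝔪` lies in the regular locus (tree `isOpen_regularLocus_of_perfectField` + basic opens form a basis);
* `exists_not_mem_forall_algebraMap_ne_zero` — `A` Noetherian, `A_𝔪` a domain, `g/1 ≠ 0` in `A_𝔪` ⇒ on some `D(h) ∋ 𝔪`,
  `g/1 ≠ 0` in EVERY `A_𝔮` (the locus `{𝔮 | g/1 = 0 in A_𝔮} = ⋃_{s g = 0} D(s)` is open and contains no generisation of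
  `𝔪`; closed sets of a Noetherian sober space with the same generisations of a point agree near it — tree
  `exists_isOpen_inter_eq_of_forall_specializes`, res-type-025 p501963);
* `localizationQuotientEquiv` — `A_Q ⧸ (a) ≃+* (A ⧸ (a))_{Q̄}` for a prime `Q ∋ a` (quotient and localisation commute),
  with `isRegularLocalRing_localization_map_iff` as its regularity reading.

## References

* H. Matsumura, *Commutative Ring Theory*, §30 Cor. to Thm. 30.5 (regular locus open over a perfect field). [Matsumura1987]
-/

noncomputable section

open IsLocalRing

set_option linter.dupNamespace false -- mandated namespace of this single-conjunct summit

namespace Summit.ResolutionOfSingularities.ResolutionOfSingularities.Theorems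

namespace LocalGameEFTOpenMonomial

universe u

/-! ## Basic opens inside an open set of `Spec A` -/

/-- An open subset of `Spec A` containing the point `𝔪` contains a basic open `D(h) ∋ 𝔪`. [folklore] -/
theorem exists_not_mem_forall_mem_of_isOpen {A : Type u} [CommRing A] {U : Set (PrimeSpectrum A)} (hU : IsOpen U)
    (𝔪 : Ideal A) [𝔪.IsPrime] (h𝔪 : (⟨𝔪, inferInstance⟩ : PrimeSpectrum A) ∈ U) :
    ∃ h : A, h ∉ 𝔪 ∧ ∀ (𝔮 : Ideal A) [𝔮.IsPrime], h ∉ 𝔮 → (⟨𝔮, inferInstance⟩ : PrimeSpectrum A) ∈ U := by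
  obtain ⟨V, ⟨r, rfl⟩, hrm, hrU⟩ :=
    PrimeSpectrum.isTopologicalBasis_basic_opens.exists_subset_of_mem_open h𝔪 hU
  exact ⟨r, hrm, fun 𝔮 _ hr𝔮 => hrU (show (⟨𝔮, inferInstance⟩ : PrimeSpectrum A) ∈ PrimeSpectrum.basicOpen r from hr𝔮)⟩

/-! ## Shrinking into the regular locus (perfect ground field) -/

/-- **A regular point has a regular basic neighbourhood**: for `A` of finite type over a perfect field `k` and a prime
`𝔪` with `A_𝔪` regular there is `h ∉ 𝔪` such that `A_𝔮` is regular for every prime `𝔮 ∌ h`.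
[cite: Matsumura1987, §30 Cor. to Thm. 30.5] -/
theorem exists_not_mem_forall_isRegularLocalRing (k A : Type u) [Field k] [PerfectField k] [CommRing A] [Algebra k A]
    [Algebra.FiniteType k A] (𝔪 : Ideal A) [𝔪.IsPrime] (hreg : IsRegularLocalRing (Localization.AtPrime 𝔪)) :
    ∃ h : A, h ∉ 𝔪 ∧ ∀ (𝔮 : Ideal A) [𝔮.IsPrime], h ∉ 𝔮 → IsRegularLocalRing (Localization.AtPrime 𝔮) := by
  obtain ⟨h, hh, H⟩ := exists_not_mem_forall_mem_of_isOpen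
    (Literature.AlgebraicGeometry.Resolution.isOpen_regularLocus_of_perfectField k A) 𝔪 hreg
  exact ⟨h, hh, fun 𝔮 _ hh𝔮 => H 𝔮 hh𝔮⟩

/-! ## Shrinking into the support of an element -/

/-- The locus where `g` vanishes in the local ring is open: `{𝔮 | g/1 = 0 in A_𝔮} = ⋃_{s·g = 0} D(s)`. [folklore] -/
theorem isOpen_setOf_algebraMap_eq_zero {A : Type u} [CommRing A] (g : A) :
    IsOpen {𝔮 : PrimeSpectrum A | algebraMap A (Localization.AtPrime 𝔮.asIdeal) g = 0} := by
  have hset : {𝔮 : PrimeSpectrum A | algebraMap A (Localization.AtPrime 𝔮.asIdeal) g = 0} =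
      ⋃ s ∈ {s : A | s * g = 0}, (PrimeSpectrum.basicOpen s : Set (PrimeSpectrum A)) := by
    ext 𝔮
    simp only [Set.mem_setOf_eq, Set.mem_iUnion, SetLike.mem_coe, PrimeSpectrum.mem_basicOpen, exists_prop]
    constructor
    · intro h0
      obtain ⟨s, hs⟩ := (IsLocalization.map_eq_zero_iff 𝔮.asIdeal.primeCompl (Localization.AtPrime 𝔮.asIdeal) g).mp h0
      exact ⟨s, hs, s.2⟩
    · rintro ⟨s, hs, hs𝔮⟩
      exact (IsLocalization.map_eq_zero_iff 𝔮.asIdeal.primeCompl _ g).mpr ⟨⟨s, hs𝔮⟩, hs⟩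
  rw [hset]
  exact isOpen_biUnion fun s _ => PrimeSpectrum.isOpen_basicOpen

/-- If `A_𝔪` is a domain and `g/1 ≠ 0` in `A_𝔪`, then `g/1 ≠ 0` in `A_𝔮` for every generisation `𝔮 ⊆ 𝔪`. [folklore] -/
theorem algebraMap_ne_zero_of_le {A : Type u} [CommRing A] {𝔪 : Ideal A} [𝔪.IsPrime]
    [IsDomain (Localization.AtPrime 𝔪)] {g : A} (hg : algebraMap A (Localization.AtPrime 𝔪) g ≠ 0)
    {𝔮 : Ideal A} [𝔮.IsPrime] (hle : 𝔮 ≤ 𝔪) : algebraMap A (Localization.AtPrime 𝔮) g ≠ 0 := by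
  intro h0
  obtain ⟨s, hs⟩ := (IsLocalization.map_eq_zero_iff 𝔮.primeCompl (Localization.AtPrime 𝔮) g).mp h0
  -- `s g = 0` with `s ∉ 𝔮`; in the domain `A_𝔪`, `g/1 ≠ 0` forces `s/1 = 0`, i.e. `t s = 0` with `t ∉ 𝔪`
  have hsg : algebraMap A (Localization.AtPrime 𝔪) (s : A) * algebraMap A (Localization.AtPrime 𝔪) g = 0 := by
    rw [← map_mul, hs, map_zero]
  have hs0 : algebraMap A (Localization.AtPrime 𝔪) (s : A) = 0 :=
    (mul_eq_zero.mp hsg).resolve_right hg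
  obtain ⟨t, ht⟩ := (IsLocalization.map_eq_zero_iff 𝔪.primeCompl (Localization.AtPrime 𝔪) (s : A)).mp hs0
  have hts : (t : A) * s ∈ 𝔮 := by rw [ht]; exact Ideal.zero_mem _
  rcases (‹𝔮.IsPrime›).mem_or_mem hts with h | h
  · exact t.2 (hle h)
  · exact s.2 h

/-- **Shrinking into the support**: `A` Noetherian, `A_𝔪` a domain, `g/1 ≠ 0` in `A_𝔪` ⇒ there is `h ∉ 𝔪` with `g/1 ≠ 0`
in `A_𝔮` for every prime `𝔮 ∌ h` (the closed complement of the vanishing locus contains every generisation of `𝔪`,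
hence agrees with `Spec A` near `𝔪` — Noetherian sober spaces, tree `exists_isOpen_inter_eq_of_forall_specializes`).
[folklore] -/
theorem exists_not_mem_forall_algebraMap_ne_zero {A : Type u} [CommRing A] [IsNoetherianRing A] (𝔪 : Ideal A)
    [𝔪.IsPrime] [IsDomain (Localization.AtPrime 𝔪)] {g : A} (hg : algebraMap A (Localization.AtPrime 𝔪) g ≠ 0) :
    ∃ h : A, h ∉ 𝔪 ∧ ∀ (𝔮 : Ideal A) [𝔮.IsPrime], h ∉ 𝔮 → algebraMap A (Localization.AtPrime 𝔮) g ≠ 0 := by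
  set Z : Set (PrimeSpectrum A) := {𝔮 | algebraMap A (Localization.AtPrime 𝔮.asIdeal) g = 0} with hZ
  have hC : IsClosed Zᶜ := (isOpen_setOf_algebraMap_eq_zero g).isClosed_compl
  obtain ⟨U, hU, hxU, hCU⟩ := exists_isOpen_inter_eq_of_forall_specializes hC isClosed_univ
    (⟨𝔪, inferInstance⟩ : PrimeSpectrum A) (fun η hη => by
      simp only [Set.mem_compl_iff, Set.mem_univ, iff_true, hZ, Set.mem_setOf_eq]
      have hle : η.asIdeal ≤ 𝔪 := (PrimeSpectrum.le_iff_specializes η ⟨𝔪, inferInstance⟩).mpr hη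
      exact algebraMap_ne_zero_of_le hg hle)
  obtain ⟨h, hh, H⟩ := exists_not_mem_forall_mem_of_isOpen hU 𝔪 hxU
  refine ⟨h, hh, fun 𝔮 _ hh𝔮 => ?_⟩
  have hmem : (⟨𝔮, inferInstance⟩ : PrimeSpectrum A) ∈ Zᶜ ∩ U := by
    rw [hCU]
    exact ⟨Set.mem_univ _, H 𝔮 hh𝔮⟩
  exact hmem.1

/-! ## Quotient and localisation commute -/

section QuotLoc

variable {A : Type u} [CommRing A] (a : A) (Q : Ideal A) [Q.IsPrime]

/-- The image prime `Q̄ = Q/(a)` of `Q ∋ a`. [folklore] -/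
theorem map_mk_isPrime (hQ : a ∈ Q) : (Q.map (Ideal.Quotient.mk (Ideal.span {a}))).IsPrime :=
  Ideal.map_isPrime_of_surjective Ideal.Quotient.mk_surjective
    (by rw [Ideal.mk_ker, Ideal.span_singleton_le_iff_mem]; exact hQ)

/-- **`A_Q ⧸ (a) ≃ (A ⧸ (a))_{Q̄}`** for a prime `Q ∋ a`: the quotient of the localisation is the localisation of the
quotient at the image prime. [folklore] -/
theorem nonempty_localizationQuotientEquiv (hQ : a ∈ Q) :
    letI := map_mk_isPrime a Q hQ
    Nonempty ((Localization.AtPrime Q ⧸ Ideal.span {algebraMap A (Localization.AtPrime Q) a}) ≃+*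
      Localization.AtPrime (Q.map (Ideal.Quotient.mk (Ideal.span {a})))) := by
  set J : Ideal A := Ideal.span {a} with hJ
  have hJQ : J ≤ Q := (Ideal.span_singleton_le_iff_mem _).mpr hQ
  set Qbar : Ideal (A ⧸ J) := Q.map (Ideal.Quotient.mk J) with hQbar
  haveI hQbarp : Qbar.IsPrime := map_mk_isPrime a Q hQ
  have hcomap : Qbar.comap (Ideal.Quotient.mk J) = Q := by
    rw [hQbar, Ideal.comap_map_of_surjective _ Ideal.Quotient.mk_surjective,
      ← RingHom.ker_eq_comap_bot, Ideal.mk_ker, sup_eq_left]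
    exact hJQ
  have hmemQ : ∀ c : A, Ideal.Quotient.mk J c ∈ Qbar ↔ c ∈ Q := fun c => by
    rw [← Ideal.mem_comap, hcomap]
  have hM : Algebra.algebraMapSubmonoid (A ⧸ J) Q.primeCompl = Qbar.primeCompl := by
    ext b
    constructor
    · rintro ⟨c, hc, rfl⟩
      exact fun h => hc ((hmemQ c).mp h)
    · intro hb
      obtain ⟨c, rfl⟩ := Ideal.Quotient.mk_surjective b
      exact ⟨c, fun h => hb ((hmemQ c).mpr h), rfl⟩
  haveI : IsLocalization.AtPrime (Localization.AtPrime Q ⧸ J.map (algebraMap A (Localization.AtPrime Q))) Qbar := by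
    have := (inferInstance : IsLocalization (Algebra.algebraMapSubmonoid (A ⧸ J) Q.primeCompl)
      (Localization.AtPrime Q ⧸ J.map (algebraMap A (Localization.AtPrime Q))))
    rwa [hM] at this
  have e := (IsLocalization.algEquiv Qbar.primeCompl
    (Localization.AtPrime Q ⧸ J.map (algebraMap A (Localization.AtPrime Q))) (Localization.AtPrime Qbar)).toRingEquiv
  have hJt : Ideal.span {algebraMap A (Localization.AtPrime Q) a} = J.map (algebraMap A (Localization.AtPrime Q)) := by
    rw [hJ, Ideal.map_span, Set.image_singleton]
  exact ⟨(Ideal.quotEquivOfEq hJt).trans e⟩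

/-- Regularity reading: `A_Q ⧸ (a)` is a regular local ring iff `(A ⧸ (a))_{Q̄}` is. [folklore] -/
theorem isRegularLocalRing_quotient_iff (hQ : a ∈ Q) :
    letI := map_mk_isPrime a Q hQ
    IsRegularLocalRing (Localization.AtPrime Q ⧸ Ideal.span {algebraMap A (Localization.AtPrime Q) a}) ↔
      IsRegularLocalRing (Localization.AtPrime (Q.map (Ideal.Quotient.mk (Ideal.span {a})))) := by
  letI := map_mk_isPrime a Q hQ
  obtain ⟨e⟩ := nonempty_localizationQuotientEquiv a Q hQ
  exact ⟨fun h => @IsRegularLocalRing.of_ringEquiv _ _ h _ _ e, fun h => @IsRegularLocalRing.of_ringEquiv _ _ h _ _ e.symm⟩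

end QuotLoc

end LocalGameEFTOpenMonomial

end Summit.ResolutionOfSingularities.ResolutionOfSingularities.Theorems

end
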